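import Summits.QuantumFields.YangMills.Theorems.UnitScaleTiltProp7SolutionHessianSupOfRegPr
import HarnessLib

/-!
# Route `UnitScaleTilt`, crux K1 «MinimiserStabilityRegPr» (stmt-QuantumFields-19200), EX row (5) `h3` (STOREY H), H-ROAD glue **H2b-GAUGE: H7's COVARIANT ½-HÖLDER LETTER IS
# GAUGE INVARIANT** — the modulus of `ω` transported to the centre along the axial tree, `y ↦ σ_c(y)·ω(y)·σ_c(y)*`, `σ_c := axialT U₀ c`, is UNCHANGED (letter by letter, norm by norm)
# under `U₀ ↦ U₀^u`, `ω ↦ Ad_u ω`: `axialT (U₀^u) c z = u(c)·axialT U₀ c z·u(z)⁻¹`, so the transported field is conjugated by the CONSTANT `u(c)`.  Hence H2 may be proved in ANY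
# gauge representative on the ball — in particular a LOCAL regular gauge `g_c` per centre `c` ([Balaban1985RegularSpaces] Thm 1 ∕ [Balaban1985BackgroundPropagators] (3.35), the
# dischargeable class; px13 g16 16:03Z ALERT: a GLOBAL small-field gauge does not exist for backgrounds with non-central Polyakov loops on few-block members) and read at `U₀`.

Cell `ym3-torus` (HUMAN RULING D-0037; rung R3 = SU(2) YM₃ on T³ — NOT d = 4, NOT infinite volume, NOT a mass gap, NOT Clay).  Width seat `ym3-torus-px13` (gen 16);
`--supports stmt-QuantumFields-19200 --as helper`; count-neutral; THEOREMS ONLY (0 `def`, 0 `sorry`, default heartbeats).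

WHAT IS PROVED (ns `Summit.QuantumFields.YangMills.Theorems.Prop7AxialHolderLetterGauge`; `P`, `j`, gauge group `G`; then member `F`, run `K`, weight `c₀`).
* §1 `holT_gaugeAct` — `holT (U^u) y w = u(y)·holT U y w·u(y + disp w)⁻¹` for EVERY word (lit ✓`hol_gaugeAct` on `ℤ^d` through ✓`pull_gaugeActT`∕✓`hol_pull`); ★`axialT_gaugeAct` —
  `axialT (U^u) c z = u(c)·axialT U c z·u(z)⁻¹` (✓`transl_disp_treeWord_rel`).
* §2 `conj_transport_gaugeAct` — `σ̄_c(z)·(u(z)W(z)u(z)*)·σ̄_c(z)* = u(c)·(σ_c(z)W(z)σ_c(z)*)·u(c)*` in `M₂(ℂ)` (`u(z)*u(z) = 1`); ★★`norm_transported_sub_gaugeAct_eq` — the normed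
  differences of H7's letter at `(U₀^u, (Ad_u ω♭)~)` and at `(U₀, ω♭~)` COINCIDE (✓`norm_frobEquiv_symm_conj_eq` at the constant `u(c)`).
* §3 ★★ `hHω_gaugeAct_iff` — H7's `hHω` binder (✓`Prop7SolutionHessianSupOfRegPr.norm_covGradT_DL2_le_of_holderLetters`) for `(U₀^u, (Ad_u ω♭)~, H_ω)` ↔ for `(U₀, ω♭~, H_ω)`,
  for any route function `ω♭ : Site → M₂(ℂ)` (every `ω : SiteL2K` is `toL2S ω♭`, `ω♭ = toL2S⁻¹ω`).
HYP-SAT (★★OWNER RULING №42).  No hypotheses beyond the data; equalities∕iff between displayed terms.  HONEST SCOPE: algebra of the gauge action; no estimate; the local regular gauge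
is NOT constructed here; nothing of H2, `h3`, EX, 19200 or the rung; the Yang–Mills mass gap is NOT proved.

References: T. Bałaban, CMP **98** (1985) 17–51 [Balaban1985Averaging] ((8)–(9) pp.18–19, p.24); CMP **99** (1985) 389–434 [Balaban1985BackgroundPropagators] ((3.28) p.395, (3.35)
p.396, p.393 «all the operators … are gauge covariant»); CMP **102** (1985) 255–275 [Balaban1985RegularSpaces] (Thm 1 p.81, (1.29)–(1.32)).
-/

set_option autoImplicit false

noncomputable section

open scoped BigOperators Matrix.Norms.L2Operator InnerProductSpace ComplexConjugate

namespace Summit.QuantumFields.YangMills.Theorems.Prop7AxialHolderLetterGauge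

open Literature.MathematicalPhysics.QuantumFieldTheory.Balaban1983to89
open Literature.MathematicalPhysics.QuantumFieldTheory.Balaban1983to89.T3ContinuumYM3Torus
open B10Eq27TorusAxialLog (axialT holT transl transl_zero hol_pull hol_pull_zero pull_gaugeActT gaugeActT_eq_gaugeAct transl_disp_treeWord_rel)
open B7Prop1Explicit (disp hol_gaugeAct)
open B4Sect5Torus (TSite tdist)
open B9Eq311L2Pairing (WL2)
open B11Eq103H1Complex (SiteL2K)
open Summit.QuantumFields.YangMills.Theorems.Prop7SectET3Transport (periodsT3 siteEquiv)
open Summit.QuantumFields.YangMills.Theorems.Prop7SectET3HilbertLetters (W₂ frobEquiv toL2S toL2S_apply)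
open Summit.QuantumFields.YangMills.Theorems.Prop7GaugeCovariancePointwise (norm_frobEquiv_symm_conj_eq)

/-! ## §1 Holonomies and the axial transporter under a gauge transformation -/

section Holonomy

variable {P : Params} {j : ℕ} {G : Type*} [GaugeGroup G]

/-- **`V^u(Γ) = u(Γ₋)·V(Γ)·u(Γ₊)⁻¹`** for every lattice word from `y` on the torus (lit ✓`hol_gaugeAct` on `ℤ^d`, read through the pullback dictionary ✓`pull_gaugeActT`, ✓`hol_pull`).
[cite: Balaban1985Averaging, (8)-(9) pp.18-19] -/
theorem holT_gaugeAct (u : GaugeTransf P j G) (V : GaugeField P j G) (y : Site P j) (w : List (B7Prop1Explicit.Letter P.d)) :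
    holT (GaugeField.gaugeAct u V) y w = u y * holT V y w * (u (transl y (disp w)))⁻¹ := by
  rw [← gaugeActT_eq_gaugeAct, ← hol_pull_zero, pull_gaugeActT, hol_gaugeAct, hol_pull_zero, transl_zero, zero_add]

/-- ★ **THE AXIAL TRANSPORTER IS GAUGE COVARIANT**: `axialT (V^u) c z = u(c)·axialT V c z·u(z)⁻¹` (the tree word from `c` ends at `z`, ✓`transl_disp_treeWord_rel`).
[cite: Balaban1985Averaging, (8) p.19, p.24] -/
theorem axialT_gaugeAct (u : GaugeTransf P j G) (V : GaugeField P j G) (c z : Site P j) :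
    axialT (GaugeField.gaugeAct u V) c z = u c * axialT V c z * (u z)⁻¹ := by
  rw [axialT, holT_gaugeAct, transl_disp_treeWord_rel, axialT]

end Holonomy

/-! ## §2 The transported field is conjugated by the constant `u(c)` -/

variable (F : T3Family) (n K : ℕ) (c₀ : ℝ)

/-- **`σ̄_c(z)·(u(z)W u(z)*)·σ̄_c(z)* = u(c)·(σ_c(z)W σ_c(z)*)·u(c)*`** in `M₂(ℂ)`, `σ̄_c = axialT (U₀^u) c`, `σ_c = axialT U₀ c` (§1 + `u(z)⁻¹u(z) = 1`, `(ABC)* = C*B*A*`).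
[cite: Balaban1985BackgroundPropagators, (3.28) p.395, p.393] -/
theorem conj_transport_gaugeAct (u : GaugeTransf (F.P K) 0 (Matrix.specialUnitaryGroup (Fin 2) ℂ)) (U₀ : GaugeField (F.P K) 0 (Matrix.specialUnitaryGroup (Fin 2) ℂ))
    (c z : Site (F.P K) 0) (W : Matrix (Fin 2) (Fin 2) ℂ) :
    ((axialT (GaugeField.gaugeAct u U₀) c z : Matrix.specialUnitaryGroup (Fin 2) ℂ) : Matrix (Fin 2) (Fin 2) ℂ)
        * (((u z : Matrix.specialUnitaryGroup (Fin 2) ℂ) : Matrix (Fin 2) (Fin 2) ℂ) * W * star ((u z : Matrix.specialUnitaryGroup (Fin 2) ℂ) : Matrix (Fin 2) (Fin 2) ℂ))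
        * star ((axialT (GaugeField.gaugeAct u U₀) c z : Matrix.specialUnitaryGroup (Fin 2) ℂ) : Matrix (Fin 2) (Fin 2) ℂ)
      = ((u c : Matrix.specialUnitaryGroup (Fin 2) ℂ) : Matrix (Fin 2) (Fin 2) ℂ)
        * (((axialT U₀ c z : Matrix.specialUnitaryGroup (Fin 2) ℂ) : Matrix (Fin 2) (Fin 2) ℂ) * W
            * star ((axialT U₀ c z : Matrix.specialUnitaryGroup (Fin 2) ℂ) : Matrix (Fin 2) (Fin 2) ℂ))
        * star ((u c : Matrix.specialUnitaryGroup (Fin 2) ℂ) : Matrix (Fin 2) (Fin 2) ℂ) := by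
  rw [axialT_gaugeAct]
  set g : Matrix (Fin 2) (Fin 2) ℂ := ((u c : Matrix.specialUnitaryGroup (Fin 2) ℂ) : Matrix (Fin 2) (Fin 2) ℂ) with hg
  set h : Matrix (Fin 2) (Fin 2) ℂ := ((u z : Matrix.specialUnitaryGroup (Fin 2) ℂ) : Matrix (Fin 2) (Fin 2) ℂ) with hh
  set s : Matrix (Fin 2) (Fin 2) ℂ := ((axialT U₀ c z : Matrix.specialUnitaryGroup (Fin 2) ℂ) : Matrix (Fin 2) (Fin 2) ℂ) with hs
  have hinv : (((u z)⁻¹ : Matrix.specialUnitaryGroup (Fin 2) ℂ) : Matrix (Fin 2) (Fin 2) ℂ) = star h := rfl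
  have hmul : ((u c * axialT U₀ c z * (u z)⁻¹ : Matrix.specialUnitaryGroup (Fin 2) ℂ) : Matrix (Fin 2) (Fin 2) ℂ) = g * s * star h := by
    rw [Submonoid.coe_mul, Submonoid.coe_mul, hinv]
  have hhu : star h * h = 1 := Unitary.star_mul_self_of_mem (u z).2.1
  rw [hmul, star_mul, star_mul, star_star]
  calc g * s * star h * (h * W * star h) * (h * (star s * star g))
      = g * s * (star h * h) * W * (star h * h) * star s * star g := by noncomm_ring
    _ = g * (s * W * star s) * star g := by rw [hhu]; noncomm_ring

/-- ★★ **THE NORMED DIFFERENCES OF H7's LETTER COINCIDE** at `(U₀^u, (Ad_u ω♭)~)` and `(U₀, ω♭~)`: for every centre `c` and sites `y, y′`,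
`‖(σ̄_c Ad_uω♭ σ̄_c*)~(y′) − (σ̄_c Ad_uω♭ σ̄_c*)~(y)‖ = ‖(σ_c ω♭ σ_c*)~(y′) − (σ_c ω♭ σ_c*)~(y)‖` (§2 + the Frobenius isometry ✓`norm_frobEquiv_symm_conj_eq` at the constant `u(c)`).
[cite: Balaban1985BackgroundPropagators, p.393, (3.35) p.396] -/
theorem norm_transported_sub_gaugeAct_eq (u : GaugeTransf (F.P K) 0 (Matrix.specialUnitaryGroup (Fin 2) ℂ)) (U₀ : GaugeField (F.P K) 0 (Matrix.specialUnitaryGroup (Fin 2) ℂ))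
    (Wf : Site (F.P K) 0 → Matrix (Fin 2) (Fin 2) ℂ) (c : Site (F.P K) 0) (y y' : TSite 3 (periodsT3 F K)) :
    ‖WL2.equiv ℂ (fun _ : TSite 3 (periodsT3 F K) => c₀) W₂
          (toL2S F K c₀ (fun z => ((axialT (GaugeField.gaugeAct u U₀) c z : Matrix.specialUnitaryGroup (Fin 2) ℂ) : Matrix (Fin 2) (Fin 2) ℂ)
            * (((u z : Matrix.specialUnitaryGroup (Fin 2) ℂ) : Matrix (Fin 2) (Fin 2) ℂ) * Wf z * star ((u z : Matrix.specialUnitaryGroup (Fin 2) ℂ) : Matrix (Fin 2) (Fin 2) ℂ))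
            * star ((axialT (GaugeField.gaugeAct u U₀) c z : Matrix.specialUnitaryGroup (Fin 2) ℂ) : Matrix (Fin 2) (Fin 2) ℂ))) y'
        - WL2.equiv ℂ (fun _ : TSite 3 (periodsT3 F K) => c₀) W₂
          (toL2S F K c₀ (fun z => ((axialT (GaugeField.gaugeAct u U₀) c z : Matrix.specialUnitaryGroup (Fin 2) ℂ) : Matrix (Fin 2) (Fin 2) ℂ)
            * (((u z : Matrix.specialUnitaryGroup (Fin 2) ℂ) : Matrix (Fin 2) (Fin 2) ℂ) * Wf z * star ((u z : Matrix.specialUnitaryGroup (Fin 2) ℂ) : Matrix (Fin 2) (Fin 2) ℂ))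
            * star ((axialT (GaugeField.gaugeAct u U₀) c z : Matrix.specialUnitaryGroup (Fin 2) ℂ) : Matrix (Fin 2) (Fin 2) ℂ))) y‖
      = ‖WL2.equiv ℂ (fun _ : TSite 3 (periodsT3 F K) => c₀) W₂
          (toL2S F K c₀ (fun z => ((axialT U₀ c z : Matrix.specialUnitaryGroup (Fin 2) ℂ) : Matrix (Fin 2) (Fin 2) ℂ) * Wf z
            * star ((axialT U₀ c z : Matrix.specialUnitaryGroup (Fin 2) ℂ) : Matrix (Fin 2) (Fin 2) ℂ))) y'
        - WL2.equiv ℂ (fun _ : TSite 3 (periodsT3 F K) => c₀) W₂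
          (toL2S F K c₀ (fun z => ((axialT U₀ c z : Matrix.specialUnitaryGroup (Fin 2) ℂ) : Matrix (Fin 2) (Fin 2) ℂ) * Wf z
            * star ((axialT U₀ c z : Matrix.specialUnitaryGroup (Fin 2) ℂ) : Matrix (Fin 2) (Fin 2) ℂ))) y‖ := by
  simp only [toL2S_apply, conj_transport_gaugeAct]
  rw [← map_sub, ← map_sub, ← sub_mul, ← mul_sub, norm_frobEquiv_symm_conj_eq]

/-! ## §3 ★★ H7's letter in one gauge ↔ in another -/

/-- ★★ **H7's COVARIANT ½-HÖLDER LETTER IS GAUGE INVARIANT**: for a route site function `ω♭` and any gauge transformation `u`, the `hHω` binder of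
✓`Prop7SolutionHessianSupOfRegPr.norm_covGradT_DL2_le_of_holderLetters` holds for `(U₀^u, (Ad_u ω♭)~, H_ω)` iff it holds for `(U₀, ω♭~, H_ω)` — so H2 may produce the letter in a
LOCAL regular gauge per centre and H8 reads it at the display's `U₀`.  (`(Ad_uω♭)~ = Φ_u(ω♭~)` by ✓`exists_adIsometries`' formula clause; `toL2S⁻¹(toL2S f) = f`.)
[cite: Balaban1985BackgroundPropagators, p.393, (3.35) p.396; Balaban1985RegularSpaces, Thm 1 p.81] -/
theorem hHω_gaugeAct_iff (u : GaugeTransf (F.P K) 0 (Matrix.specialUnitaryGroup (Fin 2) ℂ)) (U₀ : GaugeField (F.P K) 0 (Matrix.specialUnitaryGroup (Fin 2) ℂ))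
    (Wf : Site (F.P K) 0 → Matrix (Fin 2) (Fin 2) ℂ) (Hω : ℝ) :
    (∀ (c : Site (F.P K) 0) (y y' : TSite 3 (periodsT3 F K)),
      tdist (periodsT3 F K) (siteEquiv F K c) y ≤ 4 * (F.L : ℝ) ^ (K - n) + 1 → tdist (periodsT3 F K) (siteEquiv F K c) y' ≤ 4 * (F.L : ℝ) ^ (K - n) + 1 →
      ‖WL2.equiv ℂ (fun _ : TSite 3 (periodsT3 F K) => c₀) W₂
            (toL2S F K c₀ (fun z => ((axialT (GaugeField.gaugeAct u U₀) c z : Matrix.specialUnitaryGroup (Fin 2) ℂ) : Matrix (Fin 2) (Fin 2) ℂ)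
              * (toL2S F K c₀).symm (toL2S F K c₀ (fun x => ((u x : Matrix.specialUnitaryGroup (Fin 2) ℂ) : Matrix (Fin 2) (Fin 2) ℂ) * Wf x
                  * star ((u x : Matrix.specialUnitaryGroup (Fin 2) ℂ) : Matrix (Fin 2) (Fin 2) ℂ))) z
              * star ((axialT (GaugeField.gaugeAct u U₀) c z : Matrix.specialUnitaryGroup (Fin 2) ℂ) : Matrix (Fin 2) (Fin 2) ℂ))) y'
          - WL2.equiv ℂ (fun _ : TSite 3 (periodsT3 F K) => c₀) W₂
            (toL2S F K c₀ (fun z => ((axialT (GaugeField.gaugeAct u U₀) c z : Matrix.specialUnitaryGroup (Fin 2) ℂ) : Matrix (Fin 2) (Fin 2) ℂ)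
              * (toL2S F K c₀).symm (toL2S F K c₀ (fun x => ((u x : Matrix.specialUnitaryGroup (Fin 2) ℂ) : Matrix (Fin 2) (Fin 2) ℂ) * Wf x
                  * star ((u x : Matrix.specialUnitaryGroup (Fin 2) ℂ) : Matrix (Fin 2) (Fin 2) ℂ))) z
              * star ((axialT (GaugeField.gaugeAct u U₀) c z : Matrix.specialUnitaryGroup (Fin 2) ℂ) : Matrix (Fin 2) (Fin 2) ℂ))) y‖
        ≤ Hω * (tdist (periodsT3 F K) y y' / ((F.L : ℝ) ^ (K - n))) ^ ((1 : ℝ) / 2))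
    ↔ (∀ (c : Site (F.P K) 0) (y y' : TSite 3 (periodsT3 F K)),
      tdist (periodsT3 F K) (siteEquiv F K c) y ≤ 4 * (F.L : ℝ) ^ (K - n) + 1 → tdist (periodsT3 F K) (siteEquiv F K c) y' ≤ 4 * (F.L : ℝ) ^ (K - n) + 1 →
      ‖WL2.equiv ℂ (fun _ : TSite 3 (periodsT3 F K) => c₀) W₂
            (toL2S F K c₀ (fun z => ((axialT U₀ c z : Matrix.specialUnitaryGroup (Fin 2) ℂ) : Matrix (Fin 2) (Fin 2) ℂ)
              * (toL2S F K c₀).symm (toL2S F K c₀ Wf) z * star ((axialT U₀ c z : Matrix.specialUnitaryGroup (Fin 2) ℂ) : Matrix (Fin 2) (Fin 2) ℂ))) y'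
          - WL2.equiv ℂ (fun _ : TSite 3 (periodsT3 F K) => c₀) W₂
            (toL2S F K c₀ (fun z => ((axialT U₀ c z : Matrix.specialUnitaryGroup (Fin 2) ℂ) : Matrix (Fin 2) (Fin 2) ℂ)
              * (toL2S F K c₀).symm (toL2S F K c₀ Wf) z * star ((axialT U₀ c z : Matrix.specialUnitaryGroup (Fin 2) ℂ) : Matrix (Fin 2) (Fin 2) ℂ))) y‖
        ≤ Hω * (tdist (periodsT3 F K) y y' / ((F.L : ℝ) ^ (K - n))) ^ ((1 : ℝ) / 2)) := by
  simp only [LinearEquiv.symm_apply_apply, norm_transported_sub_gaugeAct_eq]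

end Summit.QuantumFields.YangMills.Theorems.Prop7AxialHolderLetterGauge

end
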